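import Literature.Probability.LatticeModels.MomentConeOrder
import Literature.Probability.LatticeModels.GKSInequalities
import Literature.Probability.LatticeModels.GaussianPairingBound
import HarnessLib

/-!
# GKS II at the level of laws: the Ising Gibbs field law is monotone in the couplings for the
# lattice GKS moment order

Companion of `MomentConeOrder.lean` (definition request `defn-MomentConeOrder`, API item (ii):
"preserved by increase of ferromagnetic couplings (GKS II; in tree for Ising as
`gksExpect_mono_of_abs_le`)"). For the tree's finite-volume Ising Gibbs measure
`isingMeasure G Λ β h bc` on a locally finite graph (Friedli–Velenik 2017, §3.1) we define the law
`isingSpinLaw G Λ β h bc` of the real field `(σ_x)_{x ∈ Λ} ∈ ℝ^Λ` (push-forward along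
`spinFieldOn Λ`), identify its correlation family with the Gibbs correlations
`⟨σ_{oddSupport x}⟩^{bc}_{Λ;β,h}` (`corrFamilyOf_isingSpinLaw`, via
`prod_spinAt_eq_spinProduct_oddSupport`), and deduce from Friedli–Velenik Exercise 3.9 (in tree:
`isingCorr_mono_params`, from GKS II `gksExpect_mono_of_abs_le`) that for the free or `+`
boundary condition, `0 ≤ β ≤ β'` and `0 ≤ h ≤ h'` imply
`isingSpinLaw G Λ β h bc ⪯ isingSpinLaw G Λ β' h' bc` in `LatticeMomentOrder`
(`isingSpinLaw_mono_params`, through `latticeMomentOrder_of_corrFamilyOf_le`).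

## References

* S. Friedli, Y. Velenik, *Statistical Mechanics of Lattice Systems*, CUP 2017, §3.1 Def. 3.1,
  §3.6.1 Thm 3.20 (GKS) and Exercise 3.9.
-/

noncomputable section

namespace Literature.Probability.LatticeModels

open _root_.MeasureTheory Finset
open scoped BigOperators

variable {V : Type*} [DecidableEq V] (G : SimpleGraph V) [G.LocallyFinite]

/-- The `±1`-valued field `(σ_x)_{x ∈ Λ}` of a configuration, read on the finite volume `Λ`.
[cite: FriedliVelenik2017, §3.1] -/
def spinFieldOn (Λ : Finset V) (σ : SpinConfig V) : Λ → ℝ := fun x => spinAt (x : V) σ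

omit [DecidableEq V] in
/-- `spinFieldOn Λ` is measurable. [folklore] -/
theorem measurable_spinFieldOn (Λ : Finset V) : Measurable (spinFieldOn Λ) :=
  measurable_pi_lambda _ fun x => measurable_spinAt (x : V)

/-- **The law of the field `(σ_x)_{x ∈ Λ} ∈ ℝ^Λ` under the finite-volume Gibbs measure
`μ^{bc}_{Λ;β,h}`** (push-forward of `isingMeasure G Λ β h bc` along `spinFieldOn Λ`), a
probability measure on `Λ → ℝ`. [cite: FriedliVelenik2017, §3.1 Def. 3.1] -/
def isingSpinLaw (Λ : Finset V) (β h : ℝ) (bc : BoundaryCondition V) : Measure (Λ → ℝ) :=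
  (isingMeasure G Λ β h bc).map (spinFieldOn Λ)

/-- The field law is a probability measure. [folklore] -/
instance isingSpinLaw.instIsProbabilityMeasure (Λ : Finset V) (β h : ℝ)
    (bc : BoundaryCondition V) : IsProbabilityMeasure (isingSpinLaw G Λ β h bc) :=
  Measure.isProbabilityMeasure_map (measurable_spinFieldOn Λ).aemeasurable

/-- A spin monomial indexed inside `Λ` is the spin product over its odd support (`σ_v² = 1`),
a subset of `Λ`. [cite: FriedliVelenik2017, §3.6.1] -/
theorem prod_spinAt_coe_eq_spinProduct {Λ : Finset V} {n : ℕ} (x : Fin n → Λ)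
    (σ : SpinConfig V) :
    ∏ i, spinAt (x i : V) σ = spinProduct ((oddSupport x).map (Function.Embedding.subtype _)) σ := by
  have h := prod_spinAt_eq_spinProduct_oddSupport x (fun v : Λ => σ v)
  rw [spinProduct, Finset.prod_map]
  rw [spinProduct] at h
  exact h

/-- The odd support of a family indexed inside `Λ` lies in `Λ`. [folklore] -/
theorem map_oddSupport_subset {Λ : Finset V} {n : ℕ} (x : Fin n → Λ) :
    (oddSupport x).map (Function.Embedding.subtype _) ⊆ Λ := by
  intro v hv
  obtain ⟨w, -, rfl⟩ := Finset.mem_map.1 hv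
  exact w.2

/-- **Correlation family of the Ising field law = the Gibbs correlations**:
`E ∏ᵢ φ(xᵢ) = ⟨σ_{oddSupport x}⟩^{bc}_{Λ;β,h}`. [cite: FriedliVelenik2017, §3.6.1] -/
theorem corrFamilyOf_isingSpinLaw (Λ : Finset V) (β h : ℝ) (bc : BoundaryCondition V) {n : ℕ}
    (x : Fin n → Λ) :
    corrFamilyOf (isingSpinLaw G Λ β h bc) n x =
      isingCorr G Λ β h bc ((oddSupport x).map (Function.Embedding.subtype _)) := by
  have hmeas : Measurable fun φ : Λ → ℝ => ∏ i, φ (x i) :=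
    Finset.measurable_prod _ fun i _ => measurable_pi_apply (x i)
  rw [corrFamilyOf_apply, isingSpinLaw,
    integral_map (measurable_spinFieldOn Λ).aemeasurable hmeas.aestronglyMeasurable]
  simp only [spinFieldOn, prod_spinAt_coe_eq_spinProduct]
  rfl

/-- The Ising field law has all mixed moments (`|σ_x| = 1`). [folklore] -/
theorem hasLatticeMoments_isingSpinLaw (Λ : Finset V) (β h : ℝ) (bc : BoundaryCondition V) :
    HasLatticeMoments (isingSpinLaw G Λ β h bc) := by
  intro n x
  have hmeas : Measurable fun φ : Λ → ℝ => ∏ i, φ (x i) :=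
    Finset.measurable_prod _ fun i _ => measurable_pi_apply (x i)
  rw [isingSpinLaw, integrable_map_measure hmeas.aestronglyMeasurable
    (measurable_spinFieldOn Λ).aemeasurable]
  refine Integrable.mono' (integrable_const (1 : ℝ))
    (hmeas.comp (measurable_spinFieldOn Λ)).aestronglyMeasurable (ae_of_all _ fun σ => ?_)
  simp only [Function.comp_apply, spinFieldOn, Real.norm_eq_abs, Finset.abs_prod, abs_spinAt,
    Finset.prod_const_one, le_refl]

/-- **GKS II at the level of laws: the Ising field law is non-decreasing in `(β, h)` for the
lattice GKS moment order** (`0 ≤ β ≤ β'`, `0 ≤ h ≤ h'`, free or `+` boundary condition):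
`μ^{bc}_{Λ;β,h} ⪯ μ^{bc}_{Λ;β',h'}` — every `⟨σ_A⟩^{bc}_{Λ;β,h}`, `A ⊆ Λ`, is non-decreasing in
the couplings (Friedli–Velenik Exercise 3.9, in tree `isingCorr_mono_params` from
`gksExpect_mono_of_abs_le`), transported by `latticeMomentOrder_of_corrFamilyOf_le`.
[cite: FriedliVelenik2017, §3.6.1 Thm 3.20 and Exercise 3.9] -/
theorem isingSpinLaw_mono_params (Λ : Finset V) {β β' h h' : ℝ} (hβ : 0 ≤ β) (hββ' : β ≤ β')
    (hh : 0 ≤ h) (hhh' : h ≤ h') {bc : BoundaryCondition V} (hbc : bc = .free ∨ bc = .plus) :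
    LatticeMomentOrder (isingSpinLaw G Λ β h bc) (isingSpinLaw G Λ β' h' bc) := by
  refine latticeMomentOrder_of_corrFamilyOf_le (hasLatticeMoments_isingSpinLaw G Λ β h bc)
    (hasLatticeMoments_isingSpinLaw G Λ β' h' bc) fun n x => ?_
  rw [corrFamilyOf_isingSpinLaw, corrFamilyOf_isingSpinLaw]
  exact isingCorr_mono_params G hβ hββ' hh hhh' hbc (map_oddSupport_subset x)

end Literature.Probability.LatticeModels
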